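import Literature.MathematicalPhysics.QuantumFieldTheory.Balaban1983to89.B9SectBGReadY
import Literature.MathematicalPhysics.QuantumFieldTheory.Balaban1983to89.B9SectBL2DictionaryY
import Literature.MathematicalPhysics.QuantumFieldTheory.Balaban1983to89.B9RWSumsCompleteGeo9YNbr

/-!
# `Balaban1983to89.B9SectBL2GReadY` — THE (3.46) `L²` READING AND WRITING OF NODE 00's BOND-SECTOR FAMILY `KACU` AT THE conj-`b` LETTERS ON THE
# BOND CARRIER `FBondY × ι` (pub-ymgap N06 row 13, G side, `L²` member — the `L²` twin of gen 12's `B9SectBGReadY`)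

T. Bałaban, *Propagators for lattice gauge theories in a background field*, Commun. Math. Phys. **99** (1985) 389–434
[`Balaban1985BackgroundPropagators`, "B9"], Thm 3.1 (3.46) p. 398, Thm 3.3 p. 399, Thm 3.4 p. 400, (3.39)–(3.41) p. 397; [4] = T. Bałaban,
*Propagators and renormalization transformations for lattice gauge theories. II*, Commun. Math. Phys. **96** (1984) 223–250
[`Balaban1984PropagatorsII`], Prop. 2.6 (2.140)–(2.141) p. 247, (2.51)–(2.52) p. 232.

statement-level skeleton of published theorems with citation tags; proofs where landed; nothing here is a claim about the Yang–Mills mass gap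

THE PRINTED LOCI (verbatim).  Theorem 3.1 (3.46) p. 398: *"Finally, we have the inequalities in L²-norms ‖hG′(U)λ‖, ‖h∇_UG′(U)λ‖, ‖hG′(U)∇*_Uλ‖,
‖h∇_U∇_UG′(U)λ‖, ‖h∇_UG′(U)∇*_Uλ‖, ‖hG′(U)∇*_U∇*_Uλ‖ ≤ B₀[(Lʲη)², Lʲη, Lʲη, 1, 1, 1]|h|e^{−δ₀d(y,y′)}‖λ‖ for supp h ⊂ Δ(y), y ∈ Λ_j, supp λ ⊂
Δ(y′)"*; Theorem 3.3 p. 399 *"with G′(U) replaced by G(U) and λ replaced by a function J defined at bonds"*; [4] (2.140) p. 247 *"‖ζTJ‖ ≤ K(y,y′)‖J‖"*.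

WHY THIS FILE (seat dag-n06-c gen 14).  gen 14's `B9SectBL2GFrameV6.L2GFrame₆` asks an instance for the `L²` READING `readGL2` (the (3.46) block of `GA` at a
base ⇒ block-ℓ² majorants of the six bond letters) and WRITING `writeGL2` (majorants at the product ⇒ the block) of the bond family.  This file is the
bond-carrier half of that dictionary for NODE 00's `KACU` (gen 12 did (3.42) in `B9SectBGReadY`; gen 9 did the SITE sector's ℓ² in `B9SectBL2DictionaryY` §0):
* §1 `ℓ²` tools on the bond carrier `FBondY i` labelled by a section `ιB` of `β` (`indB`, `cutIn_indB`, `l2OfYB_eq_l2n`, `l2NormB_smul_col_le`,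
  `l2n_blockPiece_conjB_le`, `exists_ball_boundB`, `l2OfYB_le_of_bound`);
* §2 ★ THE GENERIC `ℓ²` conj-`b` DICTIONARY ON THE BOND CARRIER (both directions, any `ℝ`-linear letter `T` of `𝔸`-valued bond functions, constant
  `c_L = √|ι|·M₂·Σ_j‖b_j‖`): `hasL2Majorant_conjB_of_indBound`, `l2OfY_liftY_le_of_hasL2Majorant_conjB`;
* §3 ★★ READ: `L2Block (kernelFamilyB i B cfg O par) B₀ δ U₁` ⇒ the six block-ℓ² majorants of `conj b` of print's six words `O`, `∇_ν∘O`, `O∘∇*_ν`,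
  `∇_ν∘O∘∇*_μ`, `∇_ν∘∇_μ∘O`, `O∘∇*_ν∘∇*_μ` (letters `cdBₗ ∕ cdsBₗ` at `cfg U₁`) with `(c_L·B₀, δ)` — `hasL2Majorant_conjB_words_of_l2BlockB`; at the record:
  `l2Block_kernelFamilyB_of_KACU_base`, ★★ `readGL2Y_KACU`;
* §4 ★★ WRITE: block-ℓ² majorants `(B_c, δ)` of `conj b` of the six words at a coded product (any `ℝ`-linear `Gb ∕ D_ν ∕ D*_ν` agreeing pointwise with
  `OA(W) ∕ ∇_{U,ν} ∕ ∇*_{U,ν}`) ⇒ `L2Block (KACU …) (c_W·B_c) δ (prod U a)` with `c_W = m_N·c_L·L²·e^{δ}` — the Δ̃-wide cut-offs of the reading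
  (`cutIn` = «supp h within torus distance 1 of Δ(y)», ≤ `m_N` labelled blocks, levels differ by ≤ 1: `len_le_of_dist_lt_M_geo9K`) — ★★ `writeGL2Y_KACU`.
Finite-dimensional linear algebra and bookkeeping over NODE 00's DEFINED readings; the (3.46) block is the HYPOTHESIS on the reading side.

HONEST SCOPE.  No estimate of [B9] is proved or asserted; the transport to the frame's letters (`GbC`, `diffLetter … k`, carrier `(κ × SiteY) × ι`), the
cross ∕ second-order orientations and the instance are the successor files.  COUNT-NEUTRAL; N06 NOT discharged; one finite lattice programme — nothing
continuum ∕ OS ∕ mass-gap ∕ Clay.  Cell `pub-ymgap` (HUMAN RULING D-0062), Track A node N06 [B9], row 13, 2026-08-29.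

RELATED IN THE TREE, NOT DUPLICATED (used by name): `B9SectBGReadY` (`eBlock_kernelFamilyB_of_KACU_base` pattern, `KACU_e_prod_eq`), `B9SectBL2DictionaryY`
(`norm_le_sum_mul_sqrt_repr`), `B9SectBL2ReadingsY` (site twins), `B9SectBGpReadingsY` (`coordEquiv_symm_eq_sum_liftY`, `liftY_eq_liftY_unit`, `coordEquiv_liftY`,
`real_smul_fun`), `B6RandomWalkL2` (`HasL2Majorant`, `l2n`, `blockPiece`), `B9RWSumsReadsNbr` (`nbr`), `B9RWSumsCompleteGeo9YNbr` (`len_le_of_dist_lt_M_geo9K`),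
`B9Thm314WholeExpansionReads` (`le_iSup_ball…`), `B9SectBStepsKSCU` (`KACU_members_base`).
-/

noncomputable section

namespace Literature.MathematicalPhysics.QuantumFieldTheory.Balaban1983to89.B9SectBL2GReadY

open Node00
open B6GlobalChartV1 (blkV1)
open B6Ineq2142KLevelV1 (β)
open B6KLevelCensusIndexV1 (KIdx)
open B6RandomWalk (blockPiece)
open B6RandomWalkL2 (l2n l2n_nonneg l2n_sq l2n_add_le l2n_sum_le l2n_smul l2n_mono HasL2Majorant hasL2Majorant_mono)
open B9Thm34Ext (toB6)
open B9FromB6 (L2Block pref6_nonneg)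
open B9GeoNormsKLevelV1 (geo9K geo9K_l2Norm_nonneg geo9K_dist_nonneg)
open B9GeoLemma21KLevelV1 (geo9K_dist_comm geo9K_dist_triangle geo9K_len_pos)
open B9Eq352DivFormLetters (conj conj_apply conj_mul coordEquiv coordEquiv_apply coordEquiv_symm_apply)
open B9CoReadingCoords (cdBₗ cdsBₗ cdBₗ_apply cdsBₗ_apply)
open B9SectBGpReadingsY (baseY coordEquiv_symm_eq_sum_liftY liftY_eq_liftY_unit coordEquiv_liftY real_smul_fun)
open B9SectBGpLettersY (decY decY_base)
open B9SectBL2DictionaryY (norm_le_sum_mul_sqrt_repr)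
open B9Thm314WholeExpansionReads (le_iSup_ball le_iSup_ball_iSup le_iSup_ball_iSup₂)
open B9PinMembersKLevelV1 (MemberY geo9Y bg9Y)
open B9Eq360DeltaPrimeAY (AfldY)
open B9SectBGpFrameCodedY (codingYx codingYx_dec)
open B9SectBCodedCarrier (pullK)
open B9SectBCodedReadingsU (KACU)
open B9SectBStepsKSCU (KACU_members_base)
open B9RWSumsReadsNbr (nbr mem_nbr)
open B9RWSumsCompleteGeo9YNbr (len_le_of_dist_lt_M_geo9K)

variable {d ℓ : ℕ} {hd : 1 ≤ d + 1} {hL : Odd (ℓ + 1) ∧ 1 < ℓ + 1} {b₀ b₁ : ℝ}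
variable {𝔸 : Type} [NormedRing 𝔸] [NormedAlgebra ℂ 𝔸] [CompleteSpace 𝔸]
variable {ι : Type} [Fintype ι]
variable (i : KIdx d ℓ hd hL b₀ b₁) (ιB : BlkY i → IBondY i) (b : Module.Basis ι ℝ 𝔸)

/-! ## §1 `ℓ²` tools on the bond carrier -/

section Tools

open Classical in
/-- the indicator cut-off of the fine bonds of the block labelled `y`. [cite: Balaban1985BackgroundPropagators, (3.46) p.398 («h»), bookkeeping] -/
def indB (y : IBondY i) : FBondY i → ℝ := fun q => if ιB (blkV1 i.hN i.D q) = y then 1 else 0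

omit [NormedAlgebra ℂ 𝔸] [CompleteSpace 𝔸] [Fintype ι] in
/-- the indicator takes the values `0`, `1`. [cite: Balaban1985BackgroundPropagators, (3.46) p.398, bookkeeping] -/
theorem indB_nonneg_le_one (y : IBondY i) (q : FBondY i) : 0 ≤ indB i ιB y q ∧ indB i ιB y q ≤ 1 := by
  unfold indB; split_ifs <;> norm_num

omit [NormedAlgebra ℂ 𝔸] [CompleteSpace 𝔸] [Fintype ι] in
/-- `|h| ≤ 1` for the indicator cut-off (the reading's `cutSup`). [cite: Balaban1985BackgroundPropagators, (3.46) p.398 («|h|»), bookkeeping] -/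
theorem cutSup_indB_le_one (y : IBondY i) : (geo9K i).cutSup (.inr (indB i ιB y)) ≤ 1 := by
  show (⨆ q, |indB i ιB y q|) ≤ 1
  refine Real.iSup_le (fun q => ?_) zero_le_one
  obtain ⟨h0, h1⟩ := indB_nonneg_le_one i ιB y q
  rw [abs_of_nonneg h0]; exact h1

omit [NormedAlgebra ℂ 𝔸] [CompleteSpace 𝔸] [Fintype ι] in
/-- the values of a bond cut-off are below the reading's `|h|`. [cite: Balaban1985BackgroundPropagators, (3.46) p.398 («|h|»), bookkeeping] -/
theorem abs_le_cutSup_inr (h : FBondY i → ℝ) (q : FBondY i) : |h q| ≤ (geo9K i).cutSup (.inr h) :=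
  le_ciSup (f := fun w : FBondY i => |h w|) (Set.finite_range _).bddAbove q

omit [NormedAlgebra ℂ 𝔸] [CompleteSpace 𝔸] [Fintype ι] in
/-- `0 ≤ |h|`. [cite: Balaban1985BackgroundPropagators, (3.46) p.398, bookkeeping] -/
theorem cutSup_inr_nonneg (h : FBondY i → ℝ) : 0 ≤ (geo9K i).cutSup (.inr h) :=
  (abs_nonneg _).trans (abs_le_cutSup_inr i h (⟨0, 0⟩ : FBondY i))

omit [NormedAlgebra ℂ 𝔸] [Fintype ι] in
/-- the indicator cut-off of the labelled block `y` is supported within torus distance `≤ 1` of `Δ(y)` (in fact in `Δ(y)`: the labelling is a section of `β`).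
[cite: Balaban1985BackgroundPropagators, (3.46) p.398 («supp h ⊂ Δ(y)»), bookkeeping] -/
theorem cutIn_indB (hι : ∀ s : BlkY i, β i.hN i.D i.hk (ιB s) = s) (y : IBondY i) : (geo9K i).cutIn (.inr (indB i ιB y)) y := by
  intro q hq
  have hqy : ιB (blkV1 i.hN i.D q) = y := by
    by_contra h
    exact hq (by unfold indB; rw [if_neg h])
  have h1 : β i.hN i.D i.hk y = blkV1 i.hN i.D q := by rw [← hqy]; exact hι _
  rw [h1]
  have : ((B6Geom246MultiLevelTorus.bondT i.D).dist (blkV1 i.hN i.D q) (blkV1 i.hN i.D q) : ℝ) = 0 := by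
    rw [SimpleGraph.dist_self, Nat.cast_zero]
  exact le_of_eq_of_le this zero_le_one

omit [NormedAlgebra ℂ 𝔸] [Fintype ι] in
/-- a bond cut-off of the reading (supported within torus distance `1` of `Δ(y)`) vanishes off the labelled blocks of the neighbourhood `nbr 1 y`.
[cite: Balaban1985BackgroundPropagators, (3.46) p.398, (3.40) p.397 (Δ̃(y)), bookkeeping] -/
theorem label_mem_nbr_of_cutIn [Fintype (geo9K i).Site] (hι : ∀ s : BlkY i, β i.hN i.D i.hk (ιB s) = s) {h : FBondY i → ℝ} {y : IBondY i}
    (hc : (geo9K i).cutIn (.inr h) y) (q : FBondY i) (hq : h q ≠ 0) : ιB (blkV1 i.hN i.D q) ∈ nbr (geo9K i) 1 y := by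
  refine (mem_nbr (g := geo9K i) (y'' := ιB (blkV1 i.hN i.D q))).2 ?_
  show ((B6Geom246MultiLevelTorus.bondT i.D).dist (β i.hN i.D i.hk (ιB (blkV1 i.hN i.D q))) (β i.hN i.D i.hk y) : ℝ) ≤ 1
  rw [hι]; exact hc q hq

omit [NormedAlgebra ℂ 𝔸] [CompleteSpace 𝔸] [Fintype ι] in
/-- the block `ℓ²` reading with cut-off `h` IS the `ℓ²` norm of `h·‖Ψ‖`. [cite: Balaban1985BackgroundPropagators, (3.46) p.398, bookkeeping] -/
theorem l2OfYB_eq_l2n (h : FBondY i → ℝ) (Ψ : FBondY i → 𝔸) : l2OfY h Ψ = l2n (fun q => h q * ‖Ψ q‖) := by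
  unfold l2OfY l2n
  rw [EuclideanSpace.norm_eq]
  congr 1
  refine Finset.sum_congr rfl fun q _ => ?_
  rw [Real.norm_eq_abs, sq_abs]

omit [NormedAlgebra ℂ 𝔸] [CompleteSpace 𝔸] [Fintype ι] in
/-- sub-additivity of the block `ℓ²` reading along finite sums for a nonnegative cut-off. [cite: Balaban1984PropagatorsII, (2.52) p.232, bookkeeping] -/
theorem l2OfYB_sum_le {h : FBondY i → ℝ} (hh : ∀ q, 0 ≤ h q) {β' : Type} (S : Finset β') (Ψ : β' → FBondY i → 𝔸) :
    l2OfY h (∑ k ∈ S, Ψ k) ≤ ∑ k ∈ S, l2OfY h (Ψ k) := by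
  rw [l2OfYB_eq_l2n]
  simp only [l2OfYB_eq_l2n]
  refine le_trans (l2n_mono (v := ∑ k ∈ S, fun q => h q * ‖Ψ k q‖) fun q => ?_) (l2n_sum_le S _)
  rw [Finset.sum_apply, Finset.sum_apply, ← Finset.mul_sum, abs_of_nonneg (mul_nonneg (hh q) (norm_nonneg _)),
    abs_of_nonneg (mul_nonneg (hh q) (Finset.sum_nonneg fun k _ => norm_nonneg _))]
  exact mul_le_mul_of_nonneg_left (norm_sum_le _ _) (hh q)

omit [CompleteSpace 𝔸] [Fintype ι] in
/-- homogeneity of the block `ℓ²` reading. [cite: Balaban1985BackgroundPropagators, (3.46) p.398, bookkeeping] -/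
theorem l2OfYB_smul {h : FBondY i → ℝ} (c : ℂ) (Ψ : FBondY i → 𝔸) : l2OfY h (c • Ψ) = ‖c‖ * l2OfY h Ψ := by
  rw [l2OfYB_eq_l2n, l2OfYB_eq_l2n, ← abs_norm, ← l2n_smul]
  congr 1
  funext q
  rw [Pi.smul_apply, Pi.smul_apply, norm_smul, smul_eq_mul]
  ring

omit [NormedAlgebra ℂ 𝔸] [CompleteSpace 𝔸] [Fintype ι] in
/-- cut-off decomposition: if `h` vanishes wherever no piece is active, and the pieces `h·1_{y″}`, `y″ ∈ N`, partition it over the labels, then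
`‖h·Ψ‖₂ ≦ Σ_{y″ ∈ N} ‖(h·1_{y″})·Ψ‖₂`. [cite: Balaban1984PropagatorsII, (2.52) p.232 («λ = Σ_{y′} Δ(y′)λ»), bookkeeping] -/
theorem l2OfYB_le_sum_pieces [DecidableEq (IBondY i)] (h : FBondY i → ℝ) (Ψ : FBondY i → 𝔸) (N : Finset (IBondY i))
    (hN : ∀ q, h q ≠ 0 → ιB (blkV1 i.hN i.D q) ∈ N) :
    l2OfY h Ψ ≤ ∑ y'' ∈ N, l2OfY (fun q => h q * indB i ιB y'' q) Ψ := by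
  have heq : (fun q => h q * ‖Ψ q‖) = ∑ y'' ∈ N, fun q => (h q * indB i ιB y'' q) * ‖Ψ q‖ := by
    funext q
    rw [Finset.sum_apply]
    by_cases hq : h q = 0
    · rw [hq]; simp
    · have hmem := hN q hq
      rw [← Finset.sum_filter_add_sum_filter_not N (fun y'' => ιB (blkV1 i.hN i.D q) = y'')]
      have h1 : ∑ y'' ∈ N.filter (fun y'' => ιB (blkV1 i.hN i.D q) = y''), h q * indB i ιB y'' q * ‖Ψ q‖ = h q * ‖Ψ q‖ := by
        have hf : N.filter (fun y'' => ιB (blkV1 i.hN i.D q) = y'') = {ιB (blkV1 i.hN i.D q)} := by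
          ext y''; simp only [Finset.mem_filter, Finset.mem_singleton]
          constructor
          · rintro ⟨-, h⟩; exact h.symm
          · intro h; exact ⟨h ▸ hmem, h.symm⟩
        rw [hf, Finset.sum_singleton]
        unfold indB; rw [if_pos rfl, mul_one]
      have h2 : ∑ y'' ∈ N.filter (fun y'' => ¬ιB (blkV1 i.hN i.D q) = y''), h q * indB i ιB y'' q * ‖Ψ q‖ = 0 := by
        refine Finset.sum_eq_zero fun y'' hy'' => ?_
        rw [Finset.mem_filter] at hy''
        unfold indB; rw [if_neg hy''.2, mul_zero, zero_mul]
      rw [h1, h2, add_zero]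
  rw [l2OfYB_eq_l2n, heq]
  refine (l2n_sum_le N _).trans (le_of_eq ?_)
  refine Finset.sum_congr rfl fun y'' _ => ?_
  rw [l2OfYB_eq_l2n]

omit [NormedRing 𝔸] [NormedAlgebra ℂ 𝔸] [CompleteSpace 𝔸] [Fintype ι] in
/-- the reading's `‖J‖` of a scalar bond function is `(Σ_q J(q)²)^{1/2}`. [cite: Balaban1985BackgroundPropagators, (3.46) p.398 («‖λ‖», «J defined at bonds»), bookkeeping] -/
theorem l2NormB_eq (J : FBondY i → ℝ) : (geo9K i).l2Norm (.inr J) = Real.sqrt (∑ q, J q ^ 2) := rfl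

omit [NormedRing 𝔸] [NormedAlgebra ℂ 𝔸] [CompleteSpace 𝔸] in
/-- a scaled coordinate column is `ℓ²`-bounded by the scale times the whole coordinate function. [cite: Balaban1984PropagatorsII, (2.51) p.232, bookkeeping] -/
theorem l2NormB_smul_col_le (u : FBondY i × ι → ℝ) (j : ι) (c : ℝ) :
    (geo9K i).l2Norm (.inr fun q => c * u (q, j)) ≤ |c| * l2n u := by
  rw [l2NormB_eq]
  have hsq : l2n u ^ 2 = ∑ p, u p ^ 2 := l2n_sq u
  rw [Fintype.sum_prod_type] at hsq
  have hcol : Real.sqrt (∑ q, u (q, j) ^ 2) ≤ l2n u := by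
    refine Real.sqrt_le_left (l2n_nonneg u) |>.mpr ?_
    rw [hsq]
    exact Finset.sum_le_sum fun q _ => Finset.single_le_sum (fun j _ => sq_nonneg (u (q, j))) (Finset.mem_univ j)
  have hc : ∑ q, (c * u (q, j)) ^ 2 = c ^ 2 * ∑ q, u (q, j) ^ 2 := by
    rw [Finset.mul_sum]; exact Finset.sum_congr rfl fun q _ => by ring
  rw [hc, Real.sqrt_mul (sq_nonneg c), Real.sqrt_sq_eq_abs]
  exact mul_le_mul_of_nonneg_left hcol (abs_nonneg c)

omit [CompleteSpace 𝔸] in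
/-- **THE `ℓ²` SIZE OF A conj-`b` BLOCK PIECE ON THE BOND CARRIER** against the `𝔸`-valued block `ℓ²` reading: with coordinate constant `M₂`,
`‖1_{y}·conj b T u‖₂ ≦ √|ι|·M₂·‖1_{Δ(y)}·(T Λ_u)‖₂`, `Λ_u = coord⁻¹ u`. [cite: Balaban1984PropagatorsII, (2.51)–(2.52) p.232; Balaban1985BackgroundPropagators, (3.39) p.397] -/
theorem l2n_blockPiece_conjB_le [Fintype (geo9K i).Site] [DecidableEq (geo9K i).Site] {M₂ : ℝ} (hM₂ : 0 ≤ M₂)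
    (hrepr : ∀ (v : 𝔸) (j : ι), |b.repr v j| ≤ M₂ * ‖v‖) (R : ℝ) (H : Prop)
    (T : Module.End ℝ (FBondY i → 𝔸)) (u : FBondY i × ι → ℝ) (y : IBondY i) :
    l2n (blockPiece (g := toB6 (geo9K i) R H) (fun p : FBondY i × ι => ιB (blkV1 i.hN i.D p.1)) y (conj b T u)) ≤
      Real.sqrt (Fintype.card ι) * M₂ * l2OfY (indB i ιB y) (T ((coordEquiv b).symm u)) := by
  have hrhs : 0 ≤ Real.sqrt (Fintype.card ι) * M₂ * l2OfY (indB i ιB y) (T ((coordEquiv b).symm u)) := by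
    unfold l2OfY; positivity
  refine (pow_le_pow_iff_left₀ (l2n_nonneg _) hrhs two_ne_zero).1 ?_
  rw [l2n_sq, mul_pow, mul_pow, Real.sq_sqrt (Nat.cast_nonneg _), l2OfY, Real.sq_sqrt (Finset.sum_nonneg fun _ _ => sq_nonneg _),
    Fintype.sum_prod_type, Finset.mul_sum]
  refine Finset.sum_le_sum fun z _ => ?_
  by_cases hz : ιB (blkV1 i.hN i.D z) = y
  · have hind : indB i ιB y z = 1 := by unfold indB; rw [if_pos hz]
    rw [hind, one_mul]
    calc ∑ j, (blockPiece (g := toB6 (geo9K i) R H) (fun p : FBondY i × ι => ιB (blkV1 i.hN i.D p.1)) y (conj b T u)) (z, j) ^ 2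
        = ∑ j, (b.repr (T ((coordEquiv b).symm u) z) j) ^ 2 := by
          refine Finset.sum_congr rfl fun j _ => ?_
          rw [blockPiece]
          dsimp only
          split_ifs with hc
          · rw [conj_apply]
          · exact absurd hz hc
      _ ≤ ∑ _j : ι, (M₂ * ‖T ((coordEquiv b).symm u) z‖) ^ 2 :=
          Finset.sum_le_sum fun j _ => by
            have h := hrepr (T ((coordEquiv b).symm u) z) j
            have h0 : 0 ≤ M₂ * ‖T ((coordEquiv b).symm u) z‖ := mul_nonneg hM₂ (norm_nonneg _)
            nlinarith [abs_nonneg (b.repr (T ((coordEquiv b).symm u) z) j), sq_abs (b.repr (T ((coordEquiv b).symm u) z) j)]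
      _ = (Fintype.card ι : ℝ) * M₂ ^ 2 * ‖T ((coordEquiv b).symm u) z‖ ^ 2 := by
          rw [Finset.sum_const, Finset.card_univ, nsmul_eq_mul]; ring
  · have h0 : ∀ j, blockPiece (g := toB6 (geo9K i) R H) (fun p : FBondY i × ι => ιB (blkV1 i.hN i.D p.1)) y (conj b T u) (z, j) = 0 :=
      fun j => by
        rw [blockPiece]
        dsimp only
        split_ifs with hc
        · exact absurd hc hz
        · rfl
    simp only [h0]
    rw [zero_pow two_ne_zero, Finset.sum_const_zero]
    positivity

omit [Fintype ι] in
/-- **EVERY LETTER IS BOUNDED ON THE UNIT BALL** (finite dimension): `‖(T(J ⊗ E))(q)‖ ≦ C` uniformly in `‖E‖ ≦ 1` and `q`. [cite: Balaban1985BackgroundPropagators, (3.39) p.397, bookkeeping] -/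
theorem exists_ball_boundB [FiniteDimensional ℝ 𝔸] (T : (FBondY i → 𝔸) →ₗ[ℝ] (FBondY i → 𝔸)) (J : FBondY i → ℝ) :
    ∃ C : ℝ, 0 ≤ C ∧ ∀ (E : BallY 𝔸) (q : FBondY i), ‖T (liftY J (E : 𝔸)) q‖ ≤ C := by
  refine ⟨‖LinearMap.toContinuousLinearMap T‖ * ‖J‖, mul_nonneg (ContinuousLinearMap.opNorm_nonneg _) (norm_nonneg _), fun E q => ?_⟩
  have hE : ‖(E : 𝔸)‖ ≤ 1 := mem_closedBall_zero_iff.1 E.2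
  have hlift : ‖liftY J (E : 𝔸)‖ ≤ ‖J‖ := by
    refine (pi_norm_le_iff_of_nonneg (norm_nonneg J)).2 fun w => ?_
    rw [liftY_apply, norm_smul, Complex.norm_real]
    exact (mul_le_of_le_one_right (norm_nonneg _) hE).trans (norm_le_pi_norm J w)
  calc ‖T (liftY J (E : 𝔸)) q‖ ≤ ‖T (liftY J (E : 𝔸))‖ := norm_le_pi_norm _ q
    _ = ‖LinearMap.toContinuousLinearMap T (liftY J (E : 𝔸))‖ := by rw [LinearMap.coe_toContinuousLinearMap']
    _ ≤ ‖LinearMap.toContinuousLinearMap T‖ * ‖liftY J (E : 𝔸)‖ := ContinuousLinearMap.le_opNorm _ _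
    _ ≤ ‖LinearMap.toContinuousLinearMap T‖ * ‖J‖ := mul_le_mul_of_nonneg_left hlift (ContinuousLinearMap.opNorm_nonneg _)

omit [NormedAlgebra ℂ 𝔸] [CompleteSpace 𝔸] [Fintype ι] in
/-- the block `ℓ²` reading is bounded by `√|bonds|·s·C` for `|h| ≦ s` and `‖Ψ‖ ≦ C` pointwise. [cite: Balaban1985BackgroundPropagators, (3.46) p.398, bookkeeping] -/
theorem l2OfYB_le_of_bound {h : FBondY i → ℝ} {s : ℝ} (hs : 0 ≤ s) (hh : ∀ q, |h q| ≤ s) {Ψ : FBondY i → 𝔸} {C : ℝ} (hC : 0 ≤ C)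
    (hΨ : ∀ q, ‖Ψ q‖ ≤ C) : l2OfY h Ψ ≤ Real.sqrt (Fintype.card (FBondY i)) * (s * C) := by
  unfold l2OfY
  rw [← Real.sqrt_sq (mul_nonneg hs hC), ← Real.sqrt_mul (Nat.cast_nonneg _)]
  refine Real.sqrt_le_sqrt ?_
  calc ∑ q, (h q * ‖Ψ q‖) ^ 2 ≤ ∑ _q : FBondY i, (s * C) ^ 2 := Finset.sum_le_sum fun q _ => by
          have h1 : |h q * ‖Ψ q‖| ≤ s * C := by
            rw [abs_mul, abs_norm]; exact mul_le_mul (hh q) (hΨ q) (norm_nonneg _) hs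
          exact sq_le_sq' (by linarith [abs_le.1 h1 |>.1]) (abs_le.1 h1).2
    _ = Fintype.card (FBondY i) * (s * C) ^ 2 := by rw [Finset.sum_const, Finset.card_univ, nsmul_eq_mul]

omit [Fintype ι] in
/-- the block `ℓ²` reading of `T(J ⊗ E)` with a fixed cut-off is bounded uniformly over the unit ball. [cite: Balaban1985BackgroundPropagators, (3.46) p.398, bookkeeping] -/
theorem exists_ball_bound_l2OfYB [FiniteDimensional ℝ 𝔸] (T : (FBondY i → 𝔸) →ₗ[ℝ] (FBondY i → 𝔸)) (J h : FBondY i → ℝ) :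
    ∃ C : ℝ, ∀ E : BallY 𝔸, l2OfY h (T (liftY J (E : 𝔸))) ≤ C := by
  obtain ⟨C, hC, hT⟩ := exists_ball_boundB i T J
  refine ⟨Real.sqrt (Fintype.card (FBondY i)) * ((geo9K i).cutSup (.inr h) * C), fun E => ?_⟩
  exact l2OfYB_le_of_bound i (cutSup_inr_nonneg i h) (abs_le_cutSup_inr i h) hC (hT E)

end Tools

/-! ## §2 ★ The generic `ℓ²` conj-`b` dictionary on the bond carrier -/

section Dictionary

variable [Fintype (geo9K i).Site] [DecidableEq (geo9K i).Site]

omit [CompleteSpace 𝔸] in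
/-- ★ **READING ⇒ `ℓ²` MAJORANT ON THE BOND CARRIER** ([4] (2.140) through coordinates): if the `ℝ`-linear letter `T` of `𝔸`-valued bond functions
satisfies, for every product-form input `J ⊗ E` with `‖E‖ ≦ 1` and `J` supported in the labelled block `y′`, the block-`ℓ²` bound `‖1_{Δ(y)}·T(J ⊗ E)‖ ≦
K(y,y′)·‖J‖` (`K ≧ 0`), then `conj b T` has the block-`ℓ²` majorant `c_L·K` on `FBondY × ι`, `c_L = √|ι|·M₂·Σ_j‖b_j‖`.
[cite: Balaban1984PropagatorsII, Prop. 2.6 (2.140) p.247, (2.51)–(2.52) p.232; Balaban1985BackgroundPropagators, (3.39) p.397, (3.46) p.398] -/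
theorem hasL2Majorant_conjB_of_indBound {M₂ : ℝ} (hM₂ : 0 ≤ M₂) (hrepr : ∀ (v : 𝔸) (j : ι), |b.repr v j| ≤ M₂ * ‖v‖) (R : ℝ) (H : Prop)
    (T : Module.End ℝ (FBondY i → 𝔸)) (K : IBondY i → IBondY i → ℝ) (hK : ∀ a a', 0 ≤ K a a')
    (hT : ∀ (J : FBondY i → ℝ) (E : 𝔸) (y y' : IBondY i), ‖E‖ ≤ 1 → (∀ q, ιB (blkV1 i.hN i.D q) ≠ y' → J q = 0) →
      l2OfY (indB i ιB y) (T (liftY J E)) ≤ K y y' * (geo9K i).l2Norm (.inr J)) :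
    HasL2Majorant (g := toB6 (geo9K i) R H) (fun p : FBondY i × ι => ιB (blkV1 i.hN i.D p.1)) (conj b T)
      (fun a a' => (Real.sqrt (Fintype.card ι) * M₂ * ∑ j, ‖b j‖) * K a a') := by
  intro y y' u hu
  have hind := indB_nonneg_le_one i ιB y
  have h1 := l2n_blockPiece_conjB_le i ιB b hM₂ hrepr R H T u y
  have hne : ∀ j, ‖b j‖ ≠ 0 := fun j => norm_ne_zero_iff.2 (b.ne_zero j)
  set uj : ι → FBondY i → ℝ := fun j q => ‖b j‖ * u (q, j) with huj
  set Ej : ι → 𝔸 := fun j => (‖b j‖⁻¹ : ℝ) • b j with hEj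
  have hEj1 : ∀ j, ‖Ej j‖ ≤ 1 := fun j => by
    rw [hEj]; dsimp only
    rw [norm_smul, norm_inv, Real.norm_eq_abs, abs_norm, inv_mul_cancel₀ (hne j)]
  have hΛ : (coordEquiv b).symm u = ∑ j, liftY (uj j) (Ej j) := by
    rw [coordEquiv_symm_eq_sum_liftY b u]
    exact Finset.sum_congr rfl fun j _ => liftY_eq_liftY_unit _ (b.ne_zero j)
  have hTΛ : T ((coordEquiv b).symm u) = ∑ j, T (liftY (uj j) (Ej j)) := by rw [hΛ, map_sum]
  have h2 : l2OfY (indB i ιB y) (T ((coordEquiv b).symm u)) ≤ ∑ j, l2OfY (indB i ιB y) (T (liftY (uj j) (Ej j))) := by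
    rw [hTΛ]; exact l2OfYB_sum_le i (fun q => (hind q).1) Finset.univ _
  have h3 : ∀ j, l2OfY (indB i ιB y) (T (liftY (uj j) (Ej j))) ≤ K y y' * (‖b j‖ * l2n u) := by
    intro j
    have hoff : ∀ q, ιB (blkV1 i.hN i.D q) ≠ y' → uj j q = 0 := fun q hq => by
      rw [huj]; dsimp only; rw [hu (q, j) hq, mul_zero]
    refine (hT (uj j) (Ej j) y y' (hEj1 j) hoff).trans (mul_le_mul_of_nonneg_left ?_ (hK y y'))
    exact (l2NormB_smul_col_le i u j ‖b j‖).trans (by rw [abs_norm])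
  have hSb : 0 ≤ ∑ j, ‖b j‖ := Finset.sum_nonneg fun _ _ => norm_nonneg _
  calc l2n (blockPiece (g := toB6 (geo9K i) R H) (fun p : FBondY i × ι => ιB (blkV1 i.hN i.D p.1)) y (conj b T u))
      ≤ Real.sqrt (Fintype.card ι) * M₂ * l2OfY (indB i ιB y) (T ((coordEquiv b).symm u)) := h1
    _ ≤ Real.sqrt (Fintype.card ι) * M₂ * ∑ j, K y y' * (‖b j‖ * l2n u) :=
        mul_le_mul_of_nonneg_left (h2.trans (Finset.sum_le_sum fun j _ => h3 j)) (by positivity)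
    _ = (Real.sqrt (Fintype.card ι) * M₂ * ∑ j, ‖b j‖) * K y y' * l2n u := by
        rw [← Finset.mul_sum, ← Finset.sum_mul]; ring

omit [CompleteSpace 𝔸] [Fintype (geo9K i).Site] [DecidableEq (geo9K i).Site] in
/-- the `ℓ²` size of the coordinates of a product-form input: `‖coord(J ⊗ E)‖₂ ≦ √|ι|·M₂·‖J‖` for `‖E‖ ≦ 1`. [cite: Balaban1984PropagatorsII, (2.51) p.232, bookkeeping] -/
theorem l2n_coordEquiv_liftYB_le {M₂ : ℝ} (hM₂ : 0 ≤ M₂) (hrepr : ∀ (v : 𝔸) (j : ι), |b.repr v j| ≤ M₂ * ‖v‖)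
    (J : FBondY i → ℝ) {E : 𝔸} (hE : ‖E‖ ≤ 1) :
    l2n (coordEquiv b (liftY J E)) ≤ Real.sqrt (Fintype.card ι) * M₂ * (geo9K i).l2Norm (.inr J) := by
  have hrhs : 0 ≤ Real.sqrt (Fintype.card ι) * M₂ * (geo9K i).l2Norm (.inr J) :=
    mul_nonneg (by positivity) (geo9K_l2Norm_nonneg i _)
  refine (pow_le_pow_iff_left₀ (l2n_nonneg _) hrhs two_ne_zero).1 ?_
  rw [l2n_sq, mul_pow, mul_pow, Real.sq_sqrt (Nat.cast_nonneg _), l2NormB_eq, Real.sq_sqrt (Finset.sum_nonneg fun _ _ => sq_nonneg _),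
    Fintype.sum_prod_type, Finset.mul_sum]
  refine Finset.sum_le_sum fun z _ => ?_
  have hr : ∀ j, (b.repr E j) ^ 2 ≤ M₂ ^ 2 := fun j => by
    have h := hrepr E j
    have h1 : |b.repr E j| ≤ M₂ := h.trans (mul_le_of_le_one_right hM₂ hE)
    nlinarith [abs_nonneg (b.repr E j), sq_abs (b.repr E j)]
  calc ∑ j, (coordEquiv b (liftY J E) (z, j)) ^ 2 = ∑ j, J z ^ 2 * (b.repr E j) ^ 2 :=
        Finset.sum_congr rfl fun j _ => by rw [coordEquiv_liftY]; ring
    _ ≤ ∑ _j : ι, J z ^ 2 * M₂ ^ 2 := Finset.sum_le_sum fun j _ => mul_le_mul_of_nonneg_left (hr j) (sq_nonneg _)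
    _ = (Fintype.card ι : ℝ) * M₂ ^ 2 * J z ^ 2 := by rw [Finset.sum_const, Finset.card_univ, nsmul_eq_mul]; ring

omit [CompleteSpace 𝔸] in
/-- ★ **`ℓ²` MAJORANT ⇒ READING ON THE BOND CARRIER** (the converse, [4] (2.140) with a general cut-off): a block-`ℓ²` majorant `K ≧ 0` of `conj b T` bounds,
for `‖E‖ ≦ 1`, `J` supported in the labelled block `y′`, `h` supported in the labelled block `y` with `|h| ≦ s`, `‖h·T(J ⊗ E)‖₂ ≦ c_L·K(y,y′)·s·‖J‖`.
[cite: Balaban1984PropagatorsII, Prop. 2.6 (2.140) p.247, (2.51) p.232; Balaban1985BackgroundPropagators, (3.46) p.398] -/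
theorem l2OfY_liftY_le_of_hasL2Majorant_conjB {M₂ : ℝ} (hM₂ : 0 ≤ M₂) (hrepr : ∀ (v : 𝔸) (j : ι), |b.repr v j| ≤ M₂ * ‖v‖) (R : ℝ) (H : Prop)
    (T : Module.End ℝ (FBondY i → 𝔸)) (K : IBondY i → IBondY i → ℝ)
    (hT : HasL2Majorant (g := toB6 (geo9K i) R H) (fun p : FBondY i × ι => ιB (blkV1 i.hN i.D p.1)) (conj b T) K)
    (J : FBondY i → ℝ) (E : 𝔸) (h : FBondY i → ℝ) (y y' : IBondY i) {s : ℝ} (hE : ‖E‖ ≤ 1) (hK : 0 ≤ K y y') (hs : 0 ≤ s)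
    (hoff : ∀ q, ιB (blkV1 i.hN i.D q) ≠ y' → J q = 0) (hcut : ∀ q, ιB (blkV1 i.hN i.D q) ≠ y → h q = 0) (hhs : ∀ q, |h q| ≤ s) :
    l2OfY h (T (liftY J E)) ≤ (Real.sqrt (Fintype.card ι) * M₂ * ∑ j, ‖b j‖) * K y y' * s * (geo9K i).l2Norm (.inr J) := by
  letI : DecidableEq (toB6 (geo9K i) R H).Site := ‹DecidableEq (geo9K i).Site›
  set Λ := liftY J E with hΛ
  set μ : FBondY i × ι → ℝ := coordEquiv b Λ with hμ
  have hΛμ : (coordEquiv b).symm μ = Λ := by rw [hμ, LinearEquiv.symm_apply_apply]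
  have hμoff : ∀ p : FBondY i × ι, ιB (blkV1 i.hN i.D p.1) ≠ y' → μ p = 0 := fun p hp => by
    rw [hμ, coordEquiv_liftY, hoff p.1 hp, zero_mul]
  have hmaj := hT y y' μ hμoff
  have hμn := l2n_coordEquiv_liftYB_le i b hM₂ hrepr J hE
  set Sb := ∑ j, ‖b j‖ with hSb
  have hSb0 : 0 ≤ Sb := Finset.sum_nonneg fun _ _ => norm_nonneg _
  have hl2 : 0 ≤ (geo9K i).l2Norm (.inr J) := geo9K_l2Norm_nonneg i _
  set P := l2n (blockPiece (g := toB6 (geo9K i) R H) (fun p : FBondY i × ι => ιB (blkV1 i.hN i.D p.1)) y (conj b T μ)) with hP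
  have hP0 : 0 ≤ P := l2n_nonneg _
  have hrow : ∀ z, (h z * ‖T Λ z‖) ^ 2 ≤ s ^ 2 * Sb ^ 2 *
      ∑ j, (blockPiece (g := toB6 (geo9K i) R H) (fun p : FBondY i × ι => ιB (blkV1 i.hN i.D p.1)) y (conj b T μ) (z, j)) ^ 2 := by
    intro z
    by_cases hz : ιB (blkV1 i.hN i.D z) = y
    · have hpc : ∀ j, blockPiece (g := toB6 (geo9K i) R H) (fun p : FBondY i × ι => ιB (blkV1 i.hN i.D p.1)) y (conj b T μ) (z, j) =
          b.repr (T Λ z) j := by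
        intro j
        rw [blockPiece]
        dsimp only
        split_ifs with hc
        · rw [conj_apply, hΛμ]
        · exact absurd hz hc
      simp only [hpc]
      have hv := norm_le_sum_mul_sqrt_repr b (T Λ z)
      have hsq : 0 ≤ ∑ j, (b.repr (T Λ z) j) ^ 2 := Finset.sum_nonneg fun _ _ => sq_nonneg _
      have h1 : ‖T Λ z‖ ^ 2 ≤ Sb ^ 2 * ∑ j, (b.repr (T Λ z) j) ^ 2 := by
        calc ‖T Λ z‖ ^ 2 ≤ (Sb * Real.sqrt (∑ j, (b.repr (T Λ z) j) ^ 2)) ^ 2 := pow_le_pow_left₀ (norm_nonneg _) hv 2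
          _ = Sb ^ 2 * ∑ j, (b.repr (T Λ z) j) ^ 2 := by rw [mul_pow, Real.sq_sqrt hsq]
      have h2 : (h z) ^ 2 ≤ s ^ 2 := by
        have := hhs z; nlinarith [abs_nonneg (h z), sq_abs (h z)]
      calc (h z * ‖T Λ z‖) ^ 2 = (h z) ^ 2 * ‖T Λ z‖ ^ 2 := by ring
        _ ≤ s ^ 2 * (Sb ^ 2 * ∑ j, (b.repr (T Λ z) j) ^ 2) := mul_le_mul h2 h1 (sq_nonneg _) (sq_nonneg _)
        _ = _ := by ring
    · rw [hcut z hz, zero_mul, zero_pow two_ne_zero]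
      exact mul_nonneg (by positivity) (Finset.sum_nonneg fun _ _ => sq_nonneg _)
  have hsum : (l2OfY h (T Λ)) ^ 2 ≤ (s * Sb * P) ^ 2 := by
    rw [l2OfY, Real.sq_sqrt (Finset.sum_nonneg fun _ _ => sq_nonneg _), mul_pow, mul_pow, hP, l2n_sq, Fintype.sum_prod_type, Finset.mul_sum]
    exact Finset.sum_le_sum fun z _ => (hrow z).trans (le_of_eq (by ring))
  have hl : l2OfY h (T Λ) ≤ s * Sb * P := by
    have h0 : 0 ≤ s * Sb * P := by positivity
    exact (pow_le_pow_iff_left₀ (by unfold l2OfY; positivity) h0 two_ne_zero).1 hsum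
  calc l2OfY h (T Λ) ≤ s * Sb * P := hl
    _ ≤ s * Sb * (K y y' * l2n μ) := mul_le_mul_of_nonneg_left hmaj (by positivity)
    _ ≤ s * Sb * (K y y' * (Real.sqrt (Fintype.card ι) * M₂ * (geo9K i).l2Norm (.inr J))) :=
        mul_le_mul_of_nonneg_left (mul_le_mul_of_nonneg_left hμn hK) (by positivity)
    _ = (Real.sqrt (Fintype.card ι) * M₂ * ∑ j, ‖b j‖) * K y y' * s * (geo9K i).l2Norm (.inr J) := by rw [hSb]; ring

end Dictionary

/-! ## §3 ★★ READ: the (3.46) block of def-Y's bond reading ⇒ the six block-`ℓ²` majorants of the conj-`b` words -/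

section Read

variable {B : B9.Backgrounds} (cfg : B.Cfg → CfgY 𝔸 i) (O : BondOpY 𝔸 i) (par : BondParY 𝔸 i) {B₀ δ : ℝ} {U₁ : B.Cfg}
variable [Fintype (geo9K i).Site]

omit [Fintype ι] [Fintype (geo9K i).Site] in
/-- the `L²` members of def-Y's bond reading at bond data (`rfl`). [cite: Balaban1985BackgroundPropagators, (3.46) p.398, bookkeeping] -/
theorem kernelFamilyB_l2_inr (n : Fin 6) (J hh : FBondY i → ℝ) :
    (kernelFamilyB i B cfg O par).l2 n U₁ (.inr J) (.inr hh) = ⨆ E : BallY 𝔸,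
      ((![l2OfY hh (O (cfg U₁) (liftY J (E : 𝔸))),
          ⨆ ν : Fin (d + 1), l2OfY hh (cdB i (cfg U₁) ν (O (cfg U₁) (liftY J (E : 𝔸)))),
          ⨆ ν : Fin (d + 1), l2OfY hh (O (cfg U₁) (cdsB i (cfg U₁) ν (liftY J (E : 𝔸)))),
          ⨆ ν : Fin (d + 1), ⨆ μ : Fin (d + 1), l2OfY hh (cdB i (cfg U₁) ν (O (cfg U₁) (cdsB i (cfg U₁) μ (liftY J (E : 𝔸))))),
          ⨆ ν : Fin (d + 1), ⨆ μ : Fin (d + 1), l2OfY hh (cdB i (cfg U₁) ν (cdB i (cfg U₁) μ (O (cfg U₁) (liftY J (E : 𝔸))))),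
          ⨆ ν : Fin (d + 1), ⨆ μ : Fin (d + 1), l2OfY hh (O (cfg U₁) (cdsB i (cfg U₁) ν (cdsB i (cfg U₁) μ (liftY J (E : 𝔸)))))] : Fin 6 → ℝ) n) := rfl

omit [Fintype ι] [Fintype (geo9K i).Site] in
/-- the support hypothesis of the reading for a source vanishing off the labelled block `y′`. [cite: Balaban1985BackgroundPropagators, (3.46) p.398 («supp J ⊂ Δ(y′)»), bookkeeping] -/
theorem suppIn_inr_of_off (hι : ∀ s : BlkY i, β i.hN i.D i.hk (ιB s) = s) {J : FBondY i → ℝ} {y' : IBondY i}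
    (hoff : ∀ q, ιB (blkV1 i.hN i.D q) ≠ y' → J q = 0) : (geo9K i).suppIn (.inr J) y' := by
  intro q hq
  have hqy : ιB (blkV1 i.hN i.D q) = y' := by by_contra h; exact hq (hoff q h)
  rw [← hqy, hι]

omit [Fintype (geo9K i).Site] in
/-- ★ the six `L²` members READ at the indicator cut-off: for `J` supported in the labelled block `y′` and `‖E‖ ≦ 1`, every printed word `w` of member `n`
satisfies `‖1_{Δ(y)}·w(J ⊗ E)‖₂ ≦ B₀·pref6(ℓ(y))_n·e^{−δd(y,y′)}·‖J‖`. [cite: Balaban1985BackgroundPropagators, Thm 3.1 (3.46) p.398, Thm 3.3 p.399] -/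
theorem l2_words_le_of_l2BlockB [FiniteDimensional ℝ 𝔸] (hι : ∀ s : BlkY i, β i.hN i.D i.hk (ιB s) = s) (hL2 : L2Block (kernelFamilyB i B cfg O par) B₀ δ U₁)
    (hB₀ : 0 ≤ B₀) (J : FBondY i → ℝ) (E : 𝔸) (y y' : IBondY i) (hE : ‖E‖ ≤ 1) (hoff : ∀ q, ιB (blkV1 i.hN i.D q) ≠ y' → J q = 0) :
    let U := cfg U₁
    let K : Fin 6 → ℝ := fun n => B₀ * B9.pref6 ((geo9K i).len y) n * Real.exp (-(δ * (geo9K i).dist y y')) * (geo9K i).l2Norm (.inr J)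
    l2OfY (indB i ιB y) (O U (liftY J E)) ≤ K 0 ∧
      (∀ ν, l2OfY (indB i ιB y) (cdB i U ν (O U (liftY J E))) ≤ K 1) ∧
      (∀ ν, l2OfY (indB i ιB y) (O U (cdsB i U ν (liftY J E))) ≤ K 2) ∧
      (∀ ν μ, l2OfY (indB i ιB y) (cdB i U ν (O U (cdsB i U μ (liftY J E)))) ≤ K 3) ∧
      (∀ ν μ, l2OfY (indB i ιB y) (cdB i U ν (cdB i U μ (O U (liftY J E)))) ≤ K 4) ∧
      (∀ ν μ, l2OfY (indB i ιB y) (O U (cdsB i U ν (cdsB i U μ (liftY J E)))) ≤ K 5) := by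
  intro U K
  have hs := suppIn_inr_of_off i ιB hι hoff
  have hc := cutIn_indB i ιB hι y
  -- the six members at `(λ = J, h = 1_{Δ(y)})`, with `|h| ≤ 1`
  have hmem : ∀ n : Fin 6, (kernelFamilyB i B cfg O par).l2 n U₁ (.inr J) (.inr (indB i ιB y)) ≤ K n := by
    intro n
    refine (hL2 n (.inr J) (.inr (indB i ιB y)) y y' hc hs).trans ?_
    have h0 : 0 ≤ B₀ * B9.pref6 ((geo9K i).len y) n := mul_nonneg hB₀ (pref6_nonneg (geo9K_len_pos i y).le n)
    have h1 : B₀ * B9.pref6 ((geo9K i).len y) n * (geo9K i).cutSup (.inr (indB i ιB y)) ≤ B₀ * B9.pref6 ((geo9K i).len y) n :=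
      mul_le_of_le_one_right h0 (cutSup_indB_le_one i ιB y)
    exact mul_le_mul_of_nonneg_right (mul_le_mul_of_nonneg_right h1 (Real.exp_nonneg _)) (geo9K_l2Norm_nonneg i _)
  set E' : BallY 𝔸 := ⟨E, mem_closedBall_zero_iff.2 hE⟩ with hE'
  -- the letters as ℝ-linear maps (for the ball bounds)
  set Oℓ : (FBondY i → 𝔸) →ₗ[ℝ] (FBondY i → 𝔸) := (O U).restrictScalars ℝ with hOℓ
  have eO : ∀ Λ, Oℓ Λ = O U Λ := fun Λ => rfl
  refine ⟨?_, fun ν => ?_, fun ν => ?_, fun ν μ => ?_, fun ν μ => ?_, fun ν μ => ?_⟩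
  · have h := hmem 0
    rw [kernelFamilyB_l2_inr] at h
    refine le_trans ?_ h
    exact le_iSup_ball (A := fun E' : BallY 𝔸 => l2OfY (indB i ιB y) (O U (liftY J (E' : 𝔸)))) (exists_ball_bound_l2OfYB i Oℓ J _) E'
  · have h := hmem 1
    rw [kernelFamilyB_l2_inr] at h
    refine le_trans ?_ h
    exact le_iSup_ball_iSup (A := fun (E' : BallY 𝔸) (ν' : Fin (d + 1)) => l2OfY (indB i ιB y) (cdB i U ν' (O U (liftY J (E' : 𝔸)))))
      (fun ν' => exists_ball_bound_l2OfYB i (cdBₗ i U ν' ∘ₗ Oℓ) J _) E' ν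
  · have h := hmem 2
    rw [kernelFamilyB_l2_inr] at h
    refine le_trans ?_ h
    exact le_iSup_ball_iSup (A := fun (E' : BallY 𝔸) (ν' : Fin (d + 1)) => l2OfY (indB i ιB y) (O U (cdsB i U ν' (liftY J (E' : 𝔸)))))
      (fun ν' => exists_ball_bound_l2OfYB i (Oℓ ∘ₗ cdsBₗ i U ν') J _) E' ν
  · have h := hmem 3
    rw [kernelFamilyB_l2_inr] at h
    refine le_trans ?_ h
    exact le_iSup_ball_iSup₂
      (A := fun (E' : BallY 𝔸) (ν' μ' : Fin (d + 1)) => l2OfY (indB i ιB y) (cdB i U ν' (O U (cdsB i U μ' (liftY J (E' : 𝔸))))))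
      (fun ν' μ' => exists_ball_bound_l2OfYB i (cdBₗ i U ν' ∘ₗ Oℓ ∘ₗ cdsBₗ i U μ') J _) E' ν μ
  · have h := hmem 4
    rw [kernelFamilyB_l2_inr] at h
    refine le_trans ?_ h
    exact le_iSup_ball_iSup₂
      (A := fun (E' : BallY 𝔸) (ν' μ' : Fin (d + 1)) => l2OfY (indB i ιB y) (cdB i U ν' (cdB i U μ' (O U (liftY J (E' : 𝔸))))))
      (fun ν' μ' => exists_ball_bound_l2OfYB i (cdBₗ i U ν' ∘ₗ cdBₗ i U μ' ∘ₗ Oℓ) J _) E' ν μ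
  · have h := hmem 5
    rw [kernelFamilyB_l2_inr] at h
    refine le_trans ?_ h
    exact le_iSup_ball_iSup₂
      (A := fun (E' : BallY 𝔸) (ν' μ' : Fin (d + 1)) => l2OfY (indB i ιB y) (O U (cdsB i U ν' (cdsB i U μ' (liftY J (E' : 𝔸))))))
      (fun ν' μ' => exists_ball_bound_l2OfYB i (Oℓ ∘ₗ cdsBₗ i U ν' ∘ₗ cdsBₗ i U μ') J _) E' ν μ

variable [DecidableEq (geo9K i).Site]

/-- ★★ **THE SIX (3.46) BLOCK-`ℓ²` MAJORANTS OF THE conj-`b` WORDS READ FROM def-Y's BOND READING** (letters `O(U)`, `cdBₗ U ν`, `cdsBₗ U ν` at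
`U = cfg U₁`, in real coordinates on `FBondY × ι`, block map `ι_B ∘ blkV1`; constant `c_L·B₀`, `c_L = √|ι|·M₂·Σ_j‖b_j‖`, profiles `ℓ², ℓ, ℓ, 1, 1, 1`, SAME
rate). [cite: Balaban1985BackgroundPropagators, Thm 3.1 (3.46) p.398, Thm 3.3 p.399; Balaban1984PropagatorsII, Prop. 2.6 (2.140) p.247, (2.51)–(2.52) p.232] -/
theorem hasL2Majorant_conjB_words_of_l2BlockB [FiniteDimensional ℝ 𝔸] (hι : ∀ s : BlkY i, β i.hN i.D i.hk (ιB s) = s)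
    {M₂ : ℝ} (hM₂ : 0 ≤ M₂) (hrepr : ∀ (v : 𝔸) (j : ι), |b.repr v j| ≤ M₂ * ‖v‖) (R : ℝ) (H : Prop)
    (hB₀ : 0 ≤ B₀) (hL2 : L2Block (kernelFamilyB i B cfg O par) B₀ δ U₁) :
    let U := cfg U₁
    let cL : ℝ := Real.sqrt (Fintype.card ι) * M₂ * ∑ j, ‖b j‖
    let K : Fin 6 → IBondY i → IBondY i → ℝ := fun n a a' => cL * (B₀ * B9.pref6 ((geo9K i).len a) n * Real.exp (-(δ * (geo9K i).dist a a')))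
    HasL2Majorant (g := toB6 (geo9K i) R H) (fun p : FBondY i × ι => ιB (blkV1 i.hN i.D p.1)) (conj b ((O U).restrictScalars ℝ)) (K 0) ∧
      (∀ ν, HasL2Majorant (g := toB6 (geo9K i) R H) (fun p : FBondY i × ι => ιB (blkV1 i.hN i.D p.1))
        (conj b (cdBₗ i U ν ∘ₗ (O U).restrictScalars ℝ)) (K 1)) ∧
      (∀ ν, HasL2Majorant (g := toB6 (geo9K i) R H) (fun p : FBondY i × ι => ιB (blkV1 i.hN i.D p.1))
        (conj b ((O U).restrictScalars ℝ ∘ₗ cdsBₗ i U ν)) (K 2)) ∧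
      (∀ ν μ, HasL2Majorant (g := toB6 (geo9K i) R H) (fun p : FBondY i × ι => ιB (blkV1 i.hN i.D p.1))
        (conj b (cdBₗ i U ν ∘ₗ (O U).restrictScalars ℝ ∘ₗ cdsBₗ i U μ)) (K 3)) ∧
      (∀ ν μ, HasL2Majorant (g := toB6 (geo9K i) R H) (fun p : FBondY i × ι => ιB (blkV1 i.hN i.D p.1))
        (conj b (cdBₗ i U ν ∘ₗ cdBₗ i U μ ∘ₗ (O U).restrictScalars ℝ)) (K 4)) ∧
      (∀ ν μ, HasL2Majorant (g := toB6 (geo9K i) R H) (fun p : FBondY i × ι => ιB (blkV1 i.hN i.D p.1))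
        (conj b ((O U).restrictScalars ℝ ∘ₗ cdsBₗ i U ν ∘ₗ cdsBₗ i U μ)) (K 5)) := by
  intro U cL K
  have hK0 : ∀ n a a', 0 ≤ B₀ * B9.pref6 ((geo9K i).len a) n * Real.exp (-(δ * (geo9K i).dist a a')) := fun n a a' =>
    mul_nonneg (mul_nonneg hB₀ (pref6_nonneg (geo9K_len_pos i a).le n)) (Real.exp_nonneg _)
  have core := fun (J : FBondY i → ℝ) (E : 𝔸) (y y' : IBondY i) (hE : ‖E‖ ≤ 1) (hoff : ∀ q, ιB (blkV1 i.hN i.D q) ≠ y' → J q = 0) =>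
    l2_words_le_of_l2BlockB i ιB cfg O par hι hL2 hB₀ J E y y' hE hoff
  refine ⟨?_, fun ν => ?_, fun ν => ?_, fun ν μ => ?_, fun ν μ => ?_, fun ν μ => ?_⟩
  · exact hasL2Majorant_conjB_of_indBound i ιB b hM₂ hrepr R H _ _ (hK0 0) fun J E y y' hE hoff => (core J E y y' hE hoff).1
  · exact hasL2Majorant_conjB_of_indBound i ιB b hM₂ hrepr R H _ _ (hK0 1) fun J E y y' hE hoff => by
      rw [LinearMap.comp_apply, cdBₗ_apply]; exact (core J E y y' hE hoff).2.1 ν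
  · exact hasL2Majorant_conjB_of_indBound i ιB b hM₂ hrepr R H _ _ (hK0 2) fun J E y y' hE hoff => by
      rw [LinearMap.comp_apply, cdsBₗ_apply]; exact (core J E y y' hE hoff).2.2.1 ν
  · exact hasL2Majorant_conjB_of_indBound i ιB b hM₂ hrepr R H _ _ (hK0 3) fun J E y y' hE hoff => by
      rw [LinearMap.comp_apply, LinearMap.comp_apply, cdsBₗ_apply, cdBₗ_apply]; exact (core J E y y' hE hoff).2.2.2.1 ν μ
  · exact hasL2Majorant_conjB_of_indBound i ιB b hM₂ hrepr R H _ _ (hK0 4) fun J E y y' hE hoff => by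
      rw [LinearMap.comp_apply, LinearMap.comp_apply, cdBₗ_apply, cdBₗ_apply]; exact (core J E y y' hE hoff).2.2.2.2.1 ν μ
  · exact hasL2Majorant_conjB_of_indBound i ιB b hM₂ hrepr R H _ _ (hK0 5) fun J E y y' hE hoff => by
      rw [LinearMap.comp_apply, LinearMap.comp_apply, cdsBₗ_apply, cdsBₗ_apply]; exact (core J E y y' hE hoff).2.2.2.2.2 ν μ

end Read

/-! ## §4 The coded bond reading `KACU` of the Sect.-B step of record: READ at a base, WRITE at a coded product -/

section Coded

variable {Mstar : ℕ} (G : Subgroup 𝔸ˣ) (x : MemberY d ℓ hd hL b₀ b₁ Mstar) (OA : BondOpY 𝔸 x.toKIdx) (parB : BondParY 𝔸 x.toKIdx)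
  (C37 C38 : ℝ → CfgY 𝔸 x.toKIdx → AfldY 𝔸 x.toKIdx → Prop)

omit [Fintype ι] in
/-- at a base configuration the (3.46) block of the coded U-letter bond reading `KACU` IS the block of def-Y's one-configuration reading `kernelFamilyB`
(`B9SectBStepsKSCU.KACU_members_base`). [cite: Balaban1985BackgroundPropagators, Thm 3.3 p.399 with (3.46) p.398, bookkeeping] -/
theorem l2Block_kernelFamilyB_of_KACU_base {B₀ δ : ℝ} {U : CfgY 𝔸 x.toKIdx} (h : L2Block (KACU G x OA parB C37 C38) B₀ δ (.base U)) :
    L2Block (kernelFamilyB x.toKIdx (bg9Y 𝔸 G x) (fun U => U) OA parB) B₀ δ U := by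
  have h' : L2Block (pullK (codingYx G x C37 C38) (kernelFamilyB x.toKIdx (bg9Y 𝔸 G x) (fun U => U) OA parB)) B₀ δ (.base U) := by
    intro n lam hh y y' hc hs
    rw [← (KACU_members_base G x OA parB C37 C38 U).2.2.2.2.1 n]
    exact h n lam hh y y' hc hs
  intro n lam hh y y' hc hs
  have h1 := h' n lam hh y y' hc hs
  have e : (pullK (codingYx G x C37 C38) (kernelFamilyB x.toKIdx (bg9Y 𝔸 G x) (fun U => U) OA parB)).l2 n (.base U) =
      (kernelFamilyB x.toKIdx (bg9Y 𝔸 G x) (fun U => U) OA parB).l2 n U := by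
    show (kernelFamilyB x.toKIdx (bg9Y 𝔸 G x) (fun U => U) OA parB).l2 n ((codingYx G x C37 C38).dec (.base U)) = _
    rw [codingYx_dec]; rfl
  rw [e] at h1
  exact h1

variable [Fintype (geo9K x.toKIdx).Site] [DecidableEq (geo9K x.toKIdx).Site] {Rr : ℝ} {Hp : Prop} (ιB : BlkY x.toKIdx → IBondY x.toKIdx)

/-- ★★ **THE SIX (3.46) BLOCK-`ℓ²` MAJORANTS OF THE BOND LETTER `OA(U)` READ FROM `KACU` AT A BASE** (def-Y's letters `OA(U)`, `cdBₗ U ν`, `cdsBₗ U ν` in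
real coordinates on `FBondY × ι`, block map `ι_B ∘ blkV1`; constant `c_L·B₀` with `c_L = √|ι|·M₂·Σ_j‖b_j‖`, profiles `ℓ², ℓ, ℓ, 1, 1, 1`, SAME rate; stated
over `geo9K x.toKIdx = geo9Y x` by `rfl`). [cite: Balaban1985BackgroundPropagators, Thm 3.3 p.399 with (3.46) p.398, Thm 3.4 p.400; Balaban1984PropagatorsII, Prop. 2.6 (2.140) p.247, (2.51) p.232] -/
theorem readGL2Y_KACU [FiniteDimensional ℝ 𝔸] (hι : ∀ s, β x.toKIdx.hN x.toKIdx.D x.toKIdx.hk (ιB s) = s)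
    {M₂ : ℝ} (hM₂ : 0 ≤ M₂) (hrepr : ∀ (v : 𝔸) (j : ι), |b.repr v j| ≤ M₂ * ‖v‖)
    {B₀ δ : ℝ} (hB₀ : 0 ≤ B₀) {U : CfgY 𝔸 x.toKIdx} (h : L2Block (KACU G x OA parB C37 C38) B₀ δ (.base U)) :
    let i := x.toKIdx
    let cL : ℝ := Real.sqrt (Fintype.card ι) * M₂ * ∑ j, ‖b j‖
    let K : Fin 6 → IBondY i → IBondY i → ℝ := fun n a a' => cL * (B₀ * B9.pref6 ((geo9K i).len a) n * Real.exp (-(δ * (geo9K i).dist a a')))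
    HasL2Majorant (g := toB6 (geo9K i) Rr Hp) (fun p : FBondY i × ι => ιB (blkV1 i.hN i.D p.1)) (conj b ((OA U).restrictScalars ℝ)) (K 0) ∧
      (∀ ν, HasL2Majorant (g := toB6 (geo9K i) Rr Hp) (fun p : FBondY i × ι => ιB (blkV1 i.hN i.D p.1))
        (conj b (cdBₗ i U ν ∘ₗ (OA U).restrictScalars ℝ)) (K 1)) ∧
      (∀ ν, HasL2Majorant (g := toB6 (geo9K i) Rr Hp) (fun p : FBondY i × ι => ιB (blkV1 i.hN i.D p.1))
        (conj b ((OA U).restrictScalars ℝ ∘ₗ cdsBₗ i U ν)) (K 2)) ∧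
      (∀ ν μ, HasL2Majorant (g := toB6 (geo9K i) Rr Hp) (fun p : FBondY i × ι => ιB (blkV1 i.hN i.D p.1))
        (conj b (cdBₗ i U ν ∘ₗ (OA U).restrictScalars ℝ ∘ₗ cdsBₗ i U μ)) (K 3)) ∧
      (∀ ν μ, HasL2Majorant (g := toB6 (geo9K i) Rr Hp) (fun p : FBondY i × ι => ιB (blkV1 i.hN i.D p.1))
        (conj b (cdBₗ i U ν ∘ₗ cdBₗ i U μ ∘ₗ (OA U).restrictScalars ℝ)) (K 4)) ∧
      (∀ ν μ, HasL2Majorant (g := toB6 (geo9K i) Rr Hp) (fun p : FBondY i × ι => ιB (blkV1 i.hN i.D p.1))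
        (conj b ((OA U).restrictScalars ℝ ∘ₗ cdsBₗ i U ν ∘ₗ cdsBₗ i U μ)) (K 5)) :=
  hasL2Majorant_conjB_words_of_l2BlockB (B := bg9Y 𝔸 G x) (U₁ := U) x.toKIdx ιB b (fun U => U) OA parB hι hM₂ hrepr Rr Hp hB₀
    (l2Block_kernelFamilyB_of_KACU_base G x OA parB C37 C38 h)

omit [Fintype (geo9K x.toKIdx).Site] [DecidableEq (geo9K x.toKIdx).Site] [Fintype ι] in
/-- at a coded product the (3.46) members of `KACU` (U-letters: differences at the base `U`, operator at the decoded product `W`) ARE those of def-Y's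
one-configuration reading of the CONSTANT letter `OA(W)` over the coded carrier read through `baseY` (`rfl`). [cite: Balaban1985BackgroundPropagators, Thm 3.4 p.400, (3.46) p.398, bookkeeping] -/
theorem KACU_l2_prod_eq (n : Fin 6) (U : CfgY 𝔸 x.toKIdx) (a : AfldY 𝔸 x.toKIdx) :
    (KACU G x OA parB C37 C38).l2 n (.prod U a) =
      (kernelFamilyB x.toKIdx (codingYx G x C37 C38).bg (baseY x.toKIdx) (fun _ => OA (decY x.toKIdx (.prod U a))) parB).l2 n (.prod U a) := rfl

omit [Fintype (geo9K x.toKIdx).Site] [DecidableEq (geo9K x.toKIdx).Site] in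
/-- the profile comparability of neighbouring blocks: for `d(y″, y) ≦ 1` (`< M`), `pref6(ℓ(y″))_n ≦ L²·pref6(ℓ(y))_n` (levels differ by at most one).
[cite: Balaban1984PropagatorsII, (2.2) p.224; Balaban1985BackgroundPropagators, (3.46) p.398, bookkeeping] -/
theorem pref6_nbr_le {y y'' : IBondY x.toKIdx} (hy : (geo9K x.toKIdx).dist y'' y ≤ 1) (n : Fin 6) :
    B9.pref6 ((geo9K x.toKIdx).len y'') n ≤ (((ℓ + 1 : ℕ) : ℝ)) ^ 2 * B9.pref6 ((geo9K x.toKIdx).len y) n := by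
  have hM : (geo9K x.toKIdx).dist y'' y < (geo9K x.toKIdx).M :=
    lt_of_le_of_lt hy (lt_of_lt_of_le (by norm_num) (B9RWSumsCompleteGeo9YNbr.eight_le_M_geo9K x.toKIdx))
  have hlen := len_le_of_dist_lt_M_geo9K x.toKIdx hM
  have hL1 : (1 : ℝ) ≤ ((ℓ + 1 : ℕ) : ℝ) := by exact_mod_cast Nat.succ_le_succ (Nat.zero_le ℓ)
  have hl0 : 0 ≤ (geo9K x.toKIdx).len y'' := (geo9K_len_pos x.toKIdx y'').le
  have hl1 : 0 ≤ (geo9K x.toKIdx).len y := (geo9K_len_pos x.toKIdx y).le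
  fin_cases n
  · show (geo9K x.toKIdx).len y'' ^ 2 ≤ (((ℓ + 1 : ℕ) : ℝ)) ^ 2 * (geo9K x.toKIdx).len y ^ 2
    rw [← mul_pow]; exact pow_le_pow_left₀ hl0 hlen 2
  · show (geo9K x.toKIdx).len y'' ≤ (((ℓ + 1 : ℕ) : ℝ)) ^ 2 * (geo9K x.toKIdx).len y
    exact hlen.trans (by nlinarith)
  · show (geo9K x.toKIdx).len y'' ≤ (((ℓ + 1 : ℕ) : ℝ)) ^ 2 * (geo9K x.toKIdx).len y
    exact hlen.trans (by nlinarith)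
  · show (1 : ℝ) ≤ (((ℓ + 1 : ℕ) : ℝ)) ^ 2 * 1
    nlinarith
  · show (1 : ℝ) ≤ (((ℓ + 1 : ℕ) : ℝ)) ^ 2 * 1
    nlinarith
  · show (1 : ℝ) ≤ (((ℓ + 1 : ℕ) : ℝ)) ^ 2 * 1
    nlinarith

/-- ★★ **WRITE FOR `KACU` AT A CODED PRODUCT, THE `L²` MEMBER** (U-letters: covariant differences at the BASE `U`, the operator at the decoded product
`W = e^{iηa}·U`): block-`ℓ²` majorants `B_c·pref6(ℓ(a))_n·e^{−δd}` of `conj b Gb`, `conj b D_ν * conj b Gb`, `conj b Gb * conj b D*_ν`,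
`conj b D_ν * conj b Gb * conj b D*_μ`, `conj b D_ν * conj b D_μ * conj b Gb`, `conj b Gb * conj b D*_ν * conj b D*_μ` — `Gb`, `D_ν`, `D*_ν` any ℝ-linear maps
agreeing pointwise with `OA(W)`, `∇_{U,ν}`, `∇*_{U,ν}` — give `L2Block (KACU …) (c_W·B_c) δ (prod U a)` at the SAME rate, `c_W = m_N·c_L·L²·e^{δ}` (`m_N` a bound
of the radius-1 neighbourhoods of the index bonds; the reading's cut-offs live within torus distance `1` of `Δ(y)`).
[cite: Balaban1985BackgroundPropagators, Thm 3.3 p.399 with (3.46) p.398, Thm 3.4 p.400, p.403 («of course with different constants»); Balaban1984PropagatorsII, Prop. 2.6 (2.140) p.247, (2.51)–(2.52) p.232] -/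
theorem writeGL2Y_KACU (hι : ∀ s, β x.toKIdx.hN x.toKIdx.D x.toKIdx.hk (ιB s) = s)
    {M₂ : ℝ} (hM₂ : 0 ≤ M₂) (hrepr : ∀ (v : 𝔸) (j : ι), |b.repr v j| ≤ M₂ * ‖v‖)
    {mN : ℕ} (hnbr : ∀ y : IBondY x.toKIdx, (nbr (geo9K x.toKIdx) 1 y).card ≤ mN)
    (U : CfgY 𝔸 x.toKIdx) (a : AfldY 𝔸 x.toKIdx)
    (Gb : Module.End ℝ (FBondY x.toKIdx → 𝔸)) (hGb : ∀ Λ, Gb Λ = OA (decY x.toKIdx (.prod U a)) Λ)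
    (D Ds : Fin (d + 1) → Module.End ℝ (FBondY x.toKIdx → 𝔸)) (hD : ∀ ν Λ, D ν Λ = cdB x.toKIdx U ν Λ)
    (hDs : ∀ ν Λ, Ds ν Λ = cdsB x.toKIdx U ν Λ) {Bc δ : ℝ} (hBc : 0 ≤ Bc) (hδ : 0 ≤ δ)
    (h0 : HasL2Majorant (g := toB6 (geo9K x.toKIdx) Rr Hp) (fun p : FBondY x.toKIdx × ι => ιB (blkV1 x.toKIdx.hN x.toKIdx.D p.1)) (conj b Gb)
      (fun a a' => Bc * (geo9K x.toKIdx).len a ^ 2 * Real.exp (-(δ * (geo9K x.toKIdx).dist a a'))))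
    (h1 : ∀ ν, HasL2Majorant (g := toB6 (geo9K x.toKIdx) Rr Hp) (fun p : FBondY x.toKIdx × ι => ιB (blkV1 x.toKIdx.hN x.toKIdx.D p.1))
      (conj b (D ν) * conj b Gb) (fun a a' => Bc * (geo9K x.toKIdx).len a * Real.exp (-(δ * (geo9K x.toKIdx).dist a a'))))
    (h2 : ∀ ν, HasL2Majorant (g := toB6 (geo9K x.toKIdx) Rr Hp) (fun p : FBondY x.toKIdx × ι => ιB (blkV1 x.toKIdx.hN x.toKIdx.D p.1))
      (conj b Gb * conj b (Ds ν)) (fun a a' => Bc * (geo9K x.toKIdx).len a * Real.exp (-(δ * (geo9K x.toKIdx).dist a a'))))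
    (h3 : ∀ ν μ, HasL2Majorant (g := toB6 (geo9K x.toKIdx) Rr Hp) (fun p : FBondY x.toKIdx × ι => ιB (blkV1 x.toKIdx.hN x.toKIdx.D p.1))
      (conj b (D ν) * conj b Gb * conj b (Ds μ)) (fun a a' => Bc * 1 * Real.exp (-(δ * (geo9K x.toKIdx).dist a a'))))
    (h4 : ∀ ν μ, HasL2Majorant (g := toB6 (geo9K x.toKIdx) Rr Hp) (fun p : FBondY x.toKIdx × ι => ιB (blkV1 x.toKIdx.hN x.toKIdx.D p.1))
      (conj b (D ν) * conj b (D μ) * conj b Gb) (fun a a' => Bc * 1 * Real.exp (-(δ * (geo9K x.toKIdx).dist a a'))))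
    (h5 : ∀ ν μ, HasL2Majorant (g := toB6 (geo9K x.toKIdx) Rr Hp) (fun p : FBondY x.toKIdx × ι => ιB (blkV1 x.toKIdx.hN x.toKIdx.D p.1))
      (conj b Gb * conj b (Ds ν) * conj b (Ds μ)) (fun a a' => Bc * 1 * Real.exp (-(δ * (geo9K x.toKIdx).dist a a')))) :
    L2Block (KACU G x OA parB C37 C38)
      ((mN : ℝ) * (Real.sqrt (Fintype.card ι) * M₂ * ∑ j, ‖b j‖) * (((ℓ + 1 : ℕ) : ℝ)) ^ 2 * Real.exp δ * Bc) δ (.prod U a) := by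
  classical
  set cL : ℝ := Real.sqrt (Fintype.card ι) * M₂ * ∑ j, ‖b j‖ with hcL
  set L2 : ℝ := (((ℓ + 1 : ℕ) : ℝ)) ^ 2 with hL2
  set W := decY x.toKIdx (.prod U a) with hW
  have hSb : 0 ≤ ∑ j, ‖b j‖ := Finset.sum_nonneg fun _ _ => norm_nonneg _
  have hcL0 : 0 ≤ cL := by positivity
  -- the six words as ONE ℝ-linear map per member∕direction, agreeing pointwise with the 𝔸-side words, with their conj-`b` majorants
  have hlen0 : ∀ y : IBondY x.toKIdx, 0 < (geo9K x.toKIdx).len y := geo9K_len_pos x.toKIdx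
  intro n lam hh y y' hc hs
  -- only bond data carry a non-zero member
  rcases lam with f | J
  · rcases hh with g | g <;>
    · show (0 : ℝ) ≤ _
      exact mul_nonneg (mul_nonneg (mul_nonneg (mul_nonneg (by positivity) (pref6_nonneg (hlen0 y).le n))
        (B9GeoNormsKLevelV1.geo9K_cutSup_nonneg x.toKIdx _)) (Real.exp_nonneg _)) (geo9K_l2Norm_nonneg x.toKIdx _)
  rcases hh with g | hh
  · show (0 : ℝ) ≤ _
    exact mul_nonneg (mul_nonneg (mul_nonneg (mul_nonneg (by positivity) (pref6_nonneg (hlen0 y).le n))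
      (B9GeoNormsKLevelV1.geo9K_cutSup_nonneg x.toKIdx _)) (Real.exp_nonneg _)) (geo9K_l2Norm_nonneg x.toKIdx _)
  -- bond data `(J, hh)`: the source vanishes off the labelled block `ιB (β y′)`, the cut-off lives on the labelled blocks of `nbr 1 y`
  set yL : IBondY x.toKIdx := ιB (β x.toKIdx.hN x.toKIdx.D x.toKIdx.hk y') with hyL
  have hoff : ∀ q, ιB (blkV1 x.toKIdx.hN x.toKIdx.D q) ≠ yL → J q = 0 := fun q hq => by
    by_contra hJ; exact hq (by rw [hyL, ← hs q hJ])
  set s : ℝ := (geo9K x.toKIdx).cutSup (.inr hh) with hsdef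
  have hs0 : 0 ≤ s := cutSup_inr_nonneg x.toKIdx hh
  have hhs : ∀ q, |hh q| ≤ s := abs_le_cutSup_inr x.toKIdx hh
  set N := nbr (geo9K x.toKIdx) 1 y with hN
  have hNmem : ∀ q, hh q ≠ 0 → ιB (blkV1 x.toKIdx.hN x.toKIdx.D q) ∈ N := label_mem_nbr_of_cutIn x.toKIdx ιB hι hc
  -- geometry of a neighbour label `y″ ∈ N`: `d(y″, yL) ≥ d(y, y′) − 1`, profiles comparable
  have hgeo : ∀ y'' ∈ N, Real.exp (-(δ * (geo9K x.toKIdx).dist y'' yL)) ≤ Real.exp δ * Real.exp (-(δ * (geo9K x.toKIdx).dist y y')) := by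
    intro y'' hy''
    rw [mem_nbr] at hy''
    rw [← Real.exp_add]
    refine Real.exp_le_exp.2 ?_
    have hdL : (geo9K x.toKIdx).dist y'' yL = (geo9K x.toKIdx).dist y'' y' := by
      show ((B6Geom246MultiLevelTorus.bondT x.toKIdx.D).dist (β x.toKIdx.hN x.toKIdx.D x.toKIdx.hk y'') (β x.toKIdx.hN x.toKIdx.D x.toKIdx.hk (ιB (β x.toKIdx.hN x.toKIdx.D x.toKIdx.hk y'))) : ℝ) =
        ((B6Geom246MultiLevelTorus.bondT x.toKIdx.D).dist (β x.toKIdx.hN x.toKIdx.D x.toKIdx.hk y'') (β x.toKIdx.hN x.toKIdx.D x.toKIdx.hk y') : ℝ)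
      rw [hι]
    have htri : (geo9K x.toKIdx).dist y y' ≤ (geo9K x.toKIdx).dist y y'' + (geo9K x.toKIdx).dist y'' y' := geo9K_dist_triangle x.toKIdx y y'' y'
    rw [geo9K_dist_comm x.toKIdx y y''] at htri
    rw [hdL]; nlinarith
  -- the bound of one piece `hh·1_{y″}` against a conj-`b` majorant of profile `w`
  have piece : ∀ (T : Module.End ℝ (FBondY x.toKIdx → 𝔸)) (w : IBondY x.toKIdx → ℝ), (∀ a, 0 ≤ w a) →
      (∀ y'' ∈ N, w y'' ≤ L2 * B9.pref6 ((geo9K x.toKIdx).len y) n) →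
      HasL2Majorant (g := toB6 (geo9K x.toKIdx) Rr Hp) (fun p : FBondY x.toKIdx × ι => ιB (blkV1 x.toKIdx.hN x.toKIdx.D p.1)) (conj b T)
        (fun a a' => Bc * w a * Real.exp (-(δ * (geo9K x.toKIdx).dist a a'))) →
      ∀ E : BallY 𝔸, l2OfY hh (T (liftY J (E : 𝔸))) ≤
        (mN : ℝ) * cL * L2 * Real.exp δ * Bc * B9.pref6 ((geo9K x.toKIdx).len y) n * s * Real.exp (-(δ * (geo9K x.toKIdx).dist y y')) *
          (geo9K x.toKIdx).l2Norm (.inr J) := by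
    intro T w hw hwle hT E
    have hE : ‖(E : 𝔸)‖ ≤ 1 := mem_closedBall_zero_iff.1 E.2
    have hsplit := l2OfYB_le_sum_pieces x.toKIdx ιB hh (T (liftY J (E : 𝔸))) N hNmem
    have hterm : ∀ y'' ∈ N, l2OfY (fun q => hh q * indB x.toKIdx ιB y'' q) (T (liftY J (E : 𝔸))) ≤
        cL * (Bc * (L2 * B9.pref6 ((geo9K x.toKIdx).len y) n) * (Real.exp δ * Real.exp (-(δ * (geo9K x.toKIdx).dist y y')))) * s *
          (geo9K x.toKIdx).l2Norm (.inr J) := by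
      intro y'' hy''
      have hK0 : 0 ≤ Bc * w y'' * Real.exp (-(δ * (geo9K x.toKIdx).dist y'' yL)) := mul_nonneg (mul_nonneg hBc (hw y'')) (Real.exp_nonneg _)
      have hcut : ∀ q, ιB (blkV1 x.toKIdx.hN x.toKIdx.D q) ≠ y'' → hh q * indB x.toKIdx ιB y'' q = 0 := fun q hq => by
        unfold indB; rw [if_neg hq, mul_zero]
      have hhs' : ∀ q, |hh q * indB x.toKIdx ιB y'' q| ≤ s := fun q => by
        obtain ⟨h0, h1⟩ := indB_nonneg_le_one x.toKIdx ιB y'' q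
        rw [abs_mul, abs_of_nonneg h0]
        exact (mul_le_of_le_one_right (abs_nonneg _) h1).trans (hhs q)
      have hb := l2OfY_liftY_le_of_hasL2Majorant_conjB x.toKIdx ιB b hM₂ hrepr Rr Hp T _ hT J (E : 𝔸) _ y'' yL hE hK0 hs0 hoff hcut hhs'
      refine hb.trans ?_
      have hl2 : 0 ≤ (geo9K x.toKIdx).l2Norm (.inr J) := geo9K_l2Norm_nonneg x.toKIdx _
      refine mul_le_mul_of_nonneg_right (mul_le_mul_of_nonneg_right (mul_le_mul_of_nonneg_left ?_ hcL0) hs0) hl2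
      exact mul_le_mul (mul_le_mul_of_nonneg_left (hwle y'' hy'') hBc) (hgeo y'' hy'') (Real.exp_nonneg _)
        (mul_nonneg hBc (mul_nonneg (by positivity) (pref6_nonneg (hlen0 y).le n)))
    have hcard : ((N.card : ℕ) : ℝ) ≤ (mN : ℝ) := by exact_mod_cast hnbr y
    have hT0 : 0 ≤ cL * (Bc * (L2 * B9.pref6 ((geo9K x.toKIdx).len y) n) * (Real.exp δ * Real.exp (-(δ * (geo9K x.toKIdx).dist y y')))) * s *
        (geo9K x.toKIdx).l2Norm (.inr J) :=
      mul_nonneg (mul_nonneg (mul_nonneg hcL0 (mul_nonneg (mul_nonneg hBc (mul_nonneg (by positivity) (pref6_nonneg (hlen0 y).le n)))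
        (by positivity))) hs0) (geo9K_l2Norm_nonneg x.toKIdx _)
    calc l2OfY hh (T (liftY J (E : 𝔸))) ≤ ∑ y'' ∈ N, l2OfY (fun q => hh q * indB x.toKIdx ιB y'' q) (T (liftY J (E : 𝔸))) := hsplit
      _ ≤ ∑ _y'' ∈ N, cL * (Bc * (L2 * B9.pref6 ((geo9K x.toKIdx).len y) n) * (Real.exp δ * Real.exp (-(δ * (geo9K x.toKIdx).dist y y')))) * s *
            (geo9K x.toKIdx).l2Norm (.inr J) := Finset.sum_le_sum hterm
      _ = (N.card : ℝ) * (cL * (Bc * (L2 * B9.pref6 ((geo9K x.toKIdx).len y) n) * (Real.exp δ * Real.exp (-(δ * (geo9K x.toKIdx).dist y y')))) * s *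
            (geo9K x.toKIdx).l2Norm (.inr J)) := by rw [Finset.sum_const, nsmul_eq_mul]
      _ ≤ (mN : ℝ) * (cL * (Bc * (L2 * B9.pref6 ((geo9K x.toKIdx).len y) n) * (Real.exp δ * Real.exp (-(δ * (geo9K x.toKIdx).dist y y')))) * s *
            (geo9K x.toKIdx).l2Norm (.inr J)) := mul_le_mul_of_nonneg_right hcard hT0
      _ = _ := by ring
  -- profile bookkeeping for the weights `ℓ², ℓ, 1` of the hypotheses against `pref6`
  have hw2 : ∀ y'' ∈ N, n = 0 → (geo9K x.toKIdx).len y'' ^ 2 ≤ L2 * B9.pref6 ((geo9K x.toKIdx).len y) n := by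
    intro y'' hy'' hn; subst hn; rw [mem_nbr] at hy''; exact pref6_nbr_le x hy'' 0
  have hw1 : ∀ y'' ∈ N, (n = 1 ∨ n = 2) → (geo9K x.toKIdx).len y'' ≤ L2 * B9.pref6 ((geo9K x.toKIdx).len y) n := by
    intro y'' hy'' hn; rw [mem_nbr] at hy''
    rcases hn with hn | hn <;> subst hn
    · exact pref6_nbr_le x hy'' 1
    · exact pref6_nbr_le x hy'' 2
  have hw0 : ∀ y'' ∈ N, (n = 3 ∨ n = 4 ∨ n = 5) → (1 : ℝ) ≤ L2 * B9.pref6 ((geo9K x.toKIdx).len y) n := by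
    intro y'' hy'' hn; rw [mem_nbr] at hy''
    rcases hn with hn | hn | hn <;> subst hn
    · exact pref6_nbr_le x hy'' 3
    · exact pref6_nbr_le x hy'' 4
    · exact pref6_nbr_le x hy'' 5
  -- the bound to prove, member by member
  have hRHS0 : 0 ≤ (mN : ℝ) * cL * L2 * Real.exp δ * Bc * B9.pref6 ((geo9K x.toKIdx).len y) n * s * Real.exp (-(δ * (geo9K x.toKIdx).dist y y')) *
      (geo9K x.toKIdx).l2Norm (.inr J) :=
    mul_nonneg (mul_nonneg (mul_nonneg (mul_nonneg (by positivity) (pref6_nonneg (hlen0 y).le n)) hs0) (Real.exp_nonneg _))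
      (geo9K_l2Norm_nonneg x.toKIdx _)
  show (KACU G x OA parB C37 C38).l2 n (.prod U a) (.inr J) (.inr hh) ≤
    (mN : ℝ) * cL * L2 * Real.exp δ * Bc * B9.pref6 ((geo9K x.toKIdx).len y) n * s * Real.exp (-(δ * (geo9K x.toKIdx).dist y y')) * (geo9K x.toKIdx).l2Norm (.inr J)
  rw [KACU_l2_prod_eq, kernelFamilyB_l2_inr]
  -- the letters at the coded product: operator `OA(W)`, differences at `baseY (prod U a) = U` (`rfl`)
  -- pointwise agreement of the ℝ-linear words with the 𝔸-side words
  have eG : ∀ Λ, OA W Λ = Gb Λ := fun Λ => (hGb Λ).symm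
  have eD : ∀ ν Λ, cdB x.toKIdx U ν Λ = D ν Λ := fun ν Λ => (hD ν Λ).symm
  have eDs : ∀ ν Λ, cdsB x.toKIdx U ν Λ = Ds ν Λ := fun ν Λ => (hDs ν Λ).symm
  refine iSup_ball_le (fun E => ?_) hRHS0
  fin_cases n
  · show l2OfY hh (OA W (liftY J (E : 𝔸))) ≤ _
    rw [eG]
    exact piece Gb (fun a => (geo9K x.toKIdx).len a ^ 2) (fun a => sq_nonneg _) (fun y'' hy'' => hw2 y'' hy'' rfl) h0 E
  · show (⨆ ν : Fin (d + 1), l2OfY hh (cdB x.toKIdx U ν (OA W (liftY J (E : 𝔸))))) ≤ _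
    refine Real.iSup_le (fun ν => ?_) hRHS0
    rw [eG, eD]
    have hT := h1 ν
    rw [← B9Eq352DivFormLetters.conj_mul] at hT
    exact piece (D ν * Gb) (fun a => (geo9K x.toKIdx).len a) (fun a => (hlen0 a).le) (fun y'' hy'' => hw1 y'' hy'' (Or.inl rfl)) hT E
  · show (⨆ ν : Fin (d + 1), l2OfY hh (OA W (cdsB x.toKIdx U ν (liftY J (E : 𝔸))))) ≤ _
    refine Real.iSup_le (fun ν => ?_) hRHS0
    rw [eDs, eG]
    have hT := h2 ν
    rw [← B9Eq352DivFormLetters.conj_mul] at hT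
    exact piece (Gb * Ds ν) (fun a => (geo9K x.toKIdx).len a) (fun a => (hlen0 a).le) (fun y'' hy'' => hw1 y'' hy'' (Or.inr rfl)) hT E
  · show (⨆ ν : Fin (d + 1), ⨆ μ : Fin (d + 1), l2OfY hh (cdB x.toKIdx U ν (OA W (cdsB x.toKIdx U μ (liftY J (E : 𝔸)))))) ≤ _
    refine Real.iSup_le (fun ν => Real.iSup_le (fun μ => ?_) hRHS0) hRHS0
    rw [eDs, eG, eD]
    have hT := h3 ν μ
    rw [← B9Eq352DivFormLetters.conj_mul, ← B9Eq352DivFormLetters.conj_mul] at hT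
    exact piece (D ν * Gb * Ds μ) (fun _ => (1 : ℝ)) (fun _ => zero_le_one) (fun y'' hy'' => hw0 y'' hy'' (Or.inl rfl))
      (hasL2Majorant_mono (g := toB6 (geo9K x.toKIdx) Rr Hp) _ hT fun a a' => le_of_eq (by ring)) E
  · show (⨆ ν : Fin (d + 1), ⨆ μ : Fin (d + 1), l2OfY hh (cdB x.toKIdx U ν (cdB x.toKIdx U μ (OA W (liftY J (E : 𝔸)))))) ≤ _
    refine Real.iSup_le (fun ν => Real.iSup_le (fun μ => ?_) hRHS0) hRHS0
    rw [eG, eD, eD]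
    have hT := h4 ν μ
    rw [← B9Eq352DivFormLetters.conj_mul, ← B9Eq352DivFormLetters.conj_mul] at hT
    exact piece (D ν * D μ * Gb) (fun _ => (1 : ℝ)) (fun _ => zero_le_one) (fun y'' hy'' => hw0 y'' hy'' (Or.inr (Or.inl rfl)))
      (hasL2Majorant_mono (g := toB6 (geo9K x.toKIdx) Rr Hp) _ hT fun a a' => le_of_eq (by ring)) E
  · show (⨆ ν : Fin (d + 1), ⨆ μ : Fin (d + 1), l2OfY hh (OA W (cdsB x.toKIdx U ν (cdsB x.toKIdx U μ (liftY J (E : 𝔸)))))) ≤ _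
    refine Real.iSup_le (fun ν => Real.iSup_le (fun μ => ?_) hRHS0) hRHS0
    rw [eDs, eDs, eG]
    have hT := h5 ν μ
    rw [← B9Eq352DivFormLetters.conj_mul, ← B9Eq352DivFormLetters.conj_mul] at hT
    exact piece (Gb * Ds ν * Ds μ) (fun _ => (1 : ℝ)) (fun _ => zero_le_one) (fun y'' hy'' => hw0 y'' hy'' (Or.inr (Or.inr rfl)))
      (hasL2Majorant_mono (g := toB6 (geo9K x.toKIdx) Rr Hp) _ hT fun a a' => le_of_eq (by ring)) E

end Coded

end Literature.MathematicalPhysics.QuantumFieldTheory.Balaban1983to89.B9SectBL2GReadY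

end
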